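import Literature.IUT.LogThetaLattice.LatticeGlueKummerCoherent
import HarnessLib

/-!
# [IUTchIII] Prop 2.1 (vi): the Kummer square is a FORMULA for the [IUTchII] Cor 4.10 (iv) unit-portion isomorphism

Mochizuki, *Inter-universal Teichmüller Theory III*, kurims manuscript (May 2020), §2, Prop 2.1 (vi) pp.60–61: "The
definition of the unit portion of the theta monoids involved [cf. [IUTchII], Corollary 4.10, (iv)] gives rise to natural
isomorphisms `†F^{⊢×}_△ ⥲ †F^{⊢×}_{env}`, `F^{⊢×}_△(†D^⊢_△) ⥲ F^{⊢×}_{env}(†D_>)` … compatible with the Kummer isomorphisms of (ii) above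
and Theorem 1.5, (iii)"; *II* (Dec 2020) Cor 4.10 (iv) p.160. [claim: Mochizuki2012, status: disputed] (D-0012 claim key).
PROOF-ONLY sequel (abc-iut-L6-t3, owner) of `LatticeGlueKummerCompatOfKits.lean` / `LatticeGlueKummerCoherent.lean`
(GAP-LEDGER G-w4d026-2).

WHAT IS PROVED. For every glue `G : LatticeGlue S` all the isomorphisms in the Prop 2.1 (vi) Kummer square except the
Frobenius-like unit-portion identification `G.linkData.unitPortion .nonGaussian` ([IUTchII] Cor 4.10 (iv), first display)
are Kummer / étale-like data; since every arrow is an isomorphism, the square holds IF AND ONLY IF that one identification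
EQUALS the explicit composite "Kummer isomorphism of Thm 1.5 (iii), then the étale-like isomorphism of Prop 2.1 (vi), then
the inverse of the `F^{⊢×μ}`-shadow of the Kummer isomorphism `†F^⊩_{env} ⥲ F^⊩_{env}(†D_>)` of Prop 2.1 (ii)"
(`LatticeGlue.kummerSquare_iff_unitPortion_eq`). Consequently the law of G-w4d026-2 imposes NO constraint on the remaining
glue data: it is satisfiable for every glue by exactly one choice of the unit-portion identification
(`LatticeGlue.existsUnique_unitPortion_kummerSquare`) — the typed form of print's "the DEFINITION of the unit portion …
gives rise to natural isomorphisms … compatible with the Kummer isomorphisms" (the Frobenius-like identification is the one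
TRANSPORTED along the Kummer isomorphisms). abc-iut-w4-d022's variant glue `twoGlueNeg` is precisely a glue whose unit-portion
identification is NOT the transported one.

Honest framing: bookkeeping over OUR typed interfaces; no side taken on [IUTchIII] Cor 3.12; typed ≠ proved.
-/

namespace Literature.IUT.LogThetaLattice

open CategoryTheory

universe u

namespace LatticeGlue

variable {S : StripFrame.{u}} (G : LatticeGlue S)

/-- **IUTchIII:Prop2.1(vi)** (kurims p.61) **The Kummer square as a formula.** The Prop 2.1 (vi) Kummer square of the glue (the
natural-isomorphism equation `unitPortion ≪≫ pilotEnvFxm_iso = kummerT ≪≫ associator ≪≫ (htToD ◁ envNat)`, field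
`KummerCoherent.kummerSquare`) holds IF AND ONLY IF the [IUTchII] Cor 4.10 (iv) unit-portion identification
`†F^{⊢×μ}_△ ⥲ †F^{⊢×μ}_{env}` IS the composite `kummerT ≪≫ associator ≪≫ (htToD ◁ envNat) ≪≫ pilotEnvFxm_iso⁻¹` — the Frobenius-like
identification transported along the Kummer isomorphisms of Thm 1.5 (iii) and Prop 2.1 (ii).
[claim: Mochizuki2012, status: disputed] -/
theorem kummerSquare_iff_unitPortion_eq :
    G.linkData.unitPortion LatticeKind.nonGaussian ≪≫ G.pilotEnvFxm_iso =
        G.kummerT ≪≫ Functor.associator S.htToD G.biCoric.dvDelta G.biCoric.fxmOfDv ≪≫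
          Functor.isoWhiskerLeft S.htToD G.envNat ↔
      G.linkData.unitPortion LatticeKind.nonGaussian =
        (G.kummerT ≪≫ Functor.associator S.htToD G.biCoric.dvDelta G.biCoric.fxmOfDv ≪≫
          Functor.isoWhiskerLeft S.htToD G.envNat) ≪≫ G.pilotEnvFxm_iso.symm := by
  have cancel : ∀ {A T E : S.HT ⥤ S.Fxm} (a : A ≅ E) (p : T ≅ E), (a ≪≫ p.symm) ≪≫ p = a := fun a p => by
    simp only [Iso.trans_assoc, Iso.symm_self_id, Iso.trans_refl]
  constructor
  · intro h
    have h' : G.linkData.unitPortion LatticeKind.nonGaussian =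
        (G.linkData.unitPortion LatticeKind.nonGaussian ≪≫ G.pilotEnvFxm_iso) ≪≫ G.pilotEnvFxm_iso.symm := by
      simp only [Iso.trans_assoc, Iso.self_symm_id, Iso.trans_refl]
    rw [h] at h'
    exact h'
  · intro h
    rw [h]
    exact cancel _ _

/-- **IUTchIII:Prop2.1(vi)** (kurims p.61) Hence for EVERY glue there is EXACTLY ONE unit-portion identification
`†F^{⊢×μ}_△ ⥲ †F^{⊢×μ}_{env}` (an isomorphism of the functors `S.HT ⥤ S.Fxm` of associated `F^{⊢×μ}`-prime-strips) for which the
Prop 2.1 (vi) Kummer square holds — the law of GAP row G-w4d026-2 constrains nothing but this one datum, which it determines.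
[claim: Mochizuki2012, status: disputed] -/
theorem existsUnique_unitPortion_kummerSquare :
    ∃! u : G.linkData.fxmDelta ≅ G.linkData.pilotTheta LatticeKind.nonGaussian ⋙ S.FglxmToFxm,
      u ≪≫ G.pilotEnvFxm_iso =
        G.kummerT ≪≫ Functor.associator S.htToD G.biCoric.dvDelta G.biCoric.fxmOfDv ≪≫
          Functor.isoWhiskerLeft S.htToD G.envNat := by
  refine ⟨(G.kummerT ≪≫ Functor.associator S.htToD G.biCoric.dvDelta G.biCoric.fxmOfDv ≪≫
      Functor.isoWhiskerLeft S.htToD G.envNat) ≪≫ G.pilotEnvFxm_iso.symm, ?_, fun u hu => ?_⟩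
  · simp only [Iso.trans_assoc, Iso.symm_self_id, Iso.trans_refl]
  · have h' : u = (u ≪≫ G.pilotEnvFxm_iso) ≪≫ G.pilotEnvFxm_iso.symm := by
      simp only [Iso.trans_assoc, Iso.self_symm_id, Iso.trans_refl]
    rw [hu] at h'
    exact h'

/-- **IUTchIII:Prop2.1(vi)** (kurims p.61) … so a glue is Kummer-coherent (`LatticeGlue.KummerCoherent`) iff its unit-portion
identification is the transported one AND its `ℝ_{>0}`-orbit datum is transport-stable (Thm 1.5 (v)): the predicate restated
with its first field in solved form. [claim: Mochizuki2012, status: disputed] -/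
theorem kummerCoherent_iff_unitPortion_eq :
    G.KummerCoherent ↔
      G.linkData.unitPortion LatticeKind.nonGaussian =
          (G.kummerT ≪≫ Functor.associator S.htToD G.biCoric.dvDelta G.biCoric.fxmOfDv ≪≫
            Functor.isoWhiskerLeft S.htToD G.envNat) ≪≫ G.pilotEnvFxm_iso.symm ∧
        ∀ {X Y : S.HT} (ξ : X ≅ Y)
          (e : G.biCoric.realifiedHT.obj X ≅ G.biCoric.realified.obj (G.biCoric.dvDelta.obj (S.htToD.obj X))),
          e ∈ G.biCoric.realifiedKummer X →
            (G.biCoric.realifiedHT.mapIso ξ).symm ≪≫ e ≪≫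
                G.biCoric.realified.mapIso (G.biCoric.dvDelta.mapIso (S.htToD.mapIso ξ)) ∈
              G.biCoric.realifiedKummer Y := by
  rw [kummerCoherent_iff, kummerSquare_iff_unitPortion_eq]

end LatticeGlue

/-- **IUTchIII:Prop2.1(vi)** (kurims p.61) abc-iut-w4-d022's variant glue `twoGlueNeg` (unit portion `−1`) is exactly a glue whose
Cor 4.10 (iv) unit-portion identification is NOT the transported one. [claim: Mochizuki2012, status: disputed] -/
theorem Witness.twoGlueNeg_unitPortion_ne_transported :
    Witness.twoGlueNeg.linkData.unitPortion LatticeKind.nonGaussian ≠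
      (Witness.twoGlueNeg.kummerT ≪≫
          Functor.associator Witness.twoFrame.htToD Witness.twoGlueNeg.biCoric.dvDelta
            Witness.twoGlueNeg.biCoric.fxmOfDv ≪≫
          Functor.isoWhiskerLeft Witness.twoFrame.htToD Witness.twoGlueNeg.envNat) ≪≫
        Witness.twoGlueNeg.pilotEnvFxm_iso.symm := fun h =>
  Witness.twoGlueNeg_not_kummerCoherent
    ((Witness.twoGlueNeg.kummerCoherent_iff_unitPortion_eq).mpr
      ⟨h, fun ξ e he => Witness.twoBiCoric.realifiedKummer_map_of_full (fun _ => rfl) ξ e he⟩)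

end Literature.IUT.LogThetaLattice
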